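import Mathlib
import HarnessLib.Audit
import Summits.PneNP.PneNP.Theorems.PstarCentreTwoDirty

/-!
# Tools for the gate budget: vertex excess over a sub-family, doubly shared non-chords (ROUND-24, O1; memo g25 §53)

FRONTIER range-avoidance ladder, rung F-N3, ROUND 24 (cell `pnp-ideate`, prover-2 memo `g25/O1-XORSPLIT-g25.md` §53; typed targets
`PstarCoreBoundTargets.TerminalFive` / `TerminalPeelable` (p646951); restricted-model proof complexity — nothing here bears on `P` versus `NP`).

Two counting refinements for the master inequality of `PstarGateBudget`:

* **`card_xverts_sdiff_le`** — in an X-connected family `E`, the XOR vertices outside a sub-family `S` with a vertex are at most `#(E ∖ S)`: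
  grow `W ⊇ xverts S` one crossing member at a time; each step consumes a member of `E ∖ S` with an endpoint outside the previous `W`.
* **`card_nonchords_add_le_card_sharedSlots`** — `#nonchords + #N₀ ≤ #sharedSlots`, `N₀` any set of members with BOTH AND slots off the boundary
  (each non-chord owns a shared AND slot, a member of `N₀` owns two).
-/

set_option linter.dupNamespace false -- `Summit.PneNP.PneNP.…`: summit = sub-problem name (D-0017 single-conjunct layout)

open Finset Literature.Computability.Complexity
open Summit.PneNP.PneNP.Theorems.PstarSALevel (varSet bdry)
open Summit.PneNP.PneNP.Theorems.PstarXCore (xpair mem_xpair xverts)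
open Summit.PneNP.PneNP.Theorems.PstarCentreFree (vars_mem_varSet)
open Summit.PneNP.PneNP.Theorems.PstarChordRepair (IsChord)
open Summit.PneNP.PneNP.Theorems.PstarCoreBoundTargets (nonchords mem_nonchords)
open Summit.PneNP.PneNP.Theorems.PstarSharingBound (sharedSlots mult)
open Summit.PneNP.PneNP.Theorems.PstarChordBridgeCentre (mem_sharedSlots)
open Summit.PneNP.PneNP.Theorems.PstarChordBridgeExchange (mem_xverts_iff)
open Summit.PneNP.PneNP.Theorems.PstarCleanCut (Crosses)
open Summit.PneNP.PneNP.Theorems.PstarCleanChordCount (two_le_mult_of_not_mem_bdry)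
open Summit.PneNP.PneNP.Theorems.PstarSkeletonSpan (XConnected xverts_mono)

namespace Summit.PneNP.PneNP.Theorems.PstarGateBudgetTools

variable {n m : ℕ}

/-- Growing a vertex set containing `xverts S`: the vertices of `E` outside `W` are at most the members of `E ∖ S` with an endpoint outside `W`. -/
theorem card_sdiff_le_aux (I : LocalMap 4 n m) {E S : Finset (Fin m)} (hconn : XConnected I E) (hSne : (xverts I S).Nonempty) :
    ∀ (k : ℕ) (W : Finset (Fin n)), xverts I S ⊆ W → W ⊆ xverts I E → (xverts I E \ W).card = k →
      (xverts I E \ W).card ≤ ((E \ S).filter fun f => ¬ xpair I f ⊆ W).card := by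
  classical
  intro k
  induction k with
  | zero => intro W _ _ h0; rw [h0]; exact Nat.zero_le _
  | succ k ih =>
    intro W hSW hWE hk
    have hWne : W.Nonempty := hSne.mono hSW
    have hWneq : W ≠ xverts I E := by
      intro h
      rw [h, sdiff_self] at hk
      exact Nat.succ_ne_zero k (hk.symm.trans rfl)
    obtain ⟨f, hf, hcr⟩ := hconn W hWE hWne hWneq
    -- the endpoint of `f` outside `W`
    obtain ⟨v, hvf, hvW⟩ : ∃ v, v ∈ xpair I f ∧ v ∉ W := by
      rcases hcr with ⟨-, h1⟩ | ⟨h0, -⟩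
      · exact ⟨I.vars f 1, (mem_xpair I).2 (Or.inr rfl), h1⟩
      · exact ⟨I.vars f 0, (mem_xpair I).2 (Or.inl rfl), h0⟩
    have hvE : v ∈ xverts I E := (mem_xverts_iff I E v).2 ⟨f, hf, hvf⟩
    have hfS : f ∉ S := fun hfS => hvW (hSW ((mem_xverts_iff I S v).2 ⟨f, hfS, hvf⟩))
    set W' := insert v W with hW'
    have hk' : (xverts I E \ W').card = k := by
      have e : xverts I E \ W' = (xverts I E \ W).erase v := by
        ext u
        rw [mem_erase, mem_sdiff, mem_sdiff, hW', mem_insert, not_or]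
        tauto
      rw [e, card_erase_of_mem (mem_sdiff.2 ⟨hvE, hvW⟩), hk]
      rfl
    have ih' := ih W' (hSW.trans (subset_insert v W)) (insert_subset hvE hWE) hk'
    -- the members with an endpoint outside `W'` have one outside `W`, and `f` is new
    have hsub : ((E \ S).filter fun g => ¬ xpair I g ⊆ W') ⊆ ((E \ S).filter fun g => ¬ xpair I g ⊆ W).erase f := by
      intro g hg
      obtain ⟨hgE, hgW'⟩ := mem_filter.1 hg
      refine mem_erase.2 ⟨fun hgf => hgW' ?_, mem_filter.2 ⟨hgE, fun h => hgW' (h.trans (subset_insert v W))⟩⟩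
      subst hgf
      intro u hu
      rcases hcr with ⟨h0, h1⟩ | ⟨h0, h1⟩ <;> rcases (mem_xpair I).1 hu with rfl | rfl <;> rcases (mem_xpair I).1 hvf with hv | hv
      all_goals first | exact mem_insert_of_mem ‹_› | (rw [hW', hv]; exact mem_insert_self _ _) | exact absurd (hv ▸ ‹_›) hvW
    have hfmem : f ∈ (E \ S).filter fun g => ¬ xpair I g ⊆ W := mem_filter.2 ⟨mem_sdiff.2 ⟨hf, hfS⟩, fun h => hvW (h hvf)⟩
    have h1 := card_le_card hsub
    rw [card_erase_of_mem hfmem] at h1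
    have hpos : 0 < ((E \ S).filter fun g => ¬ xpair I g ⊆ W).card := card_pos.2 ⟨f, hfmem⟩
    rw [hk]
    omega

/-- **VERTEX EXCESS.**  In an X-connected family `E` with a sub-family `S` that has an XOR vertex, `#(xverts E ∖ xverts S) ≤ #(E ∖ S)`. -/
theorem card_xverts_sdiff_le (I : LocalMap 4 n m) {E S : Finset (Fin m)} (hconn : XConnected I E) (hSE : S ⊆ E)
    (hSne : (xverts I S).Nonempty) : (xverts I E \ xverts I S).card ≤ (E \ S).card := by
  classical
  exact (card_sdiff_le_aux I hconn hSne _ (xverts I S) Subset.rfl (xverts_mono I hSE) rfl).trans (card_filter_le _ _)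

/-- **DOUBLY SHARED NON-CHORDS.**  `#nonchords + #N₀ ≤ #sharedSlots` for any set `N₀ ⊆ J₀` of members with both AND variables off the boundary. -/
theorem card_nonchords_add_le_card_sharedSlots (I : LocalMap 4 n m) (J₀ : Finset (Fin m)) {N₀ : Finset (Fin m)} (hN₀ : N₀ ⊆ J₀)
    (hboth : ∀ f ∈ N₀, I.vars f 2 ∉ bdry I J₀ ∧ I.vars f 3 ∉ bdry I J₀) :
    (nonchords I J₀).card + N₀.card ≤ (sharedSlots I J₀).card := by
  classical
  -- the slot owned by a non-chord (slot `2` if shared, else slot `3`), and slot `3` of a member of `N₀` whose slot `2` is shared too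
  set φ : Fin m → Fin m × Fin 4 := fun f => if I.vars f 2 ∉ bdry I J₀ then (f, 2) else (f, 3) with hφ
  set A := (nonchords I J₀).image φ with hA
  set B := N₀.image fun f => (f, (3 : Fin 4)) with hB
  have hAcard : A.card = (nonchords I J₀).card := by
    refine card_image_of_injOn fun f _ f' _ h => ?_
    have key : ∀ g : Fin m, (φ g).1 = g := fun g => by simp only [hφ]; split_ifs <;> rfl
    rw [← key f, ← key f', h]
  have hBcard : B.card = N₀.card := card_image_of_injective _ fun f f' h => (Prod.mk.inj h).1
  have hAB : Disjoint A B := by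
    rw [disjoint_left]
    intro p hpA hpB
    obtain ⟨f, hf, rfl⟩ := mem_image.1 hpA
    obtain ⟨f', hf', he⟩ := mem_image.1 hpB
    have h2 : I.vars f 2 ∉ bdry I J₀ := by
      have := (Prod.mk.inj (show (f', (3 : Fin 4)) = φ f from he))
      by_cases h : I.vars f 2 ∉ bdry I J₀
      · exact h
      · exfalso
        simp only [hφ, if_neg h] at he
        exact h ((Prod.mk.inj he).1 ▸ (hboth f' hf').1)
    simp only [hφ, if_pos h2] at he
    exact absurd (Prod.mk.inj he).2 (by decide)
  have hsub : A ∪ B ⊆ sharedSlots I J₀ := by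
    intro p hp
    rcases mem_union.1 hp with hp | hp
    · obtain ⟨f, hf, rfl⟩ := mem_image.1 hp
      obtain ⟨hfJ, hnc⟩ := (mem_nonchords I).1 hf
      unfold PstarChordRepair.IsChord at hnc
      by_cases h2 : I.vars f 2 ∉ bdry I J₀
      · simp only [hφ, if_pos h2]
        exact mem_sharedSlots.2 ⟨hfJ, (by decide : 2 ≤ (2 : Fin 4).val), two_le_mult_of_not_mem_bdry I hfJ (vars_mem_varSet I f 2) h2⟩
      · simp only [hφ, if_neg h2]
        have h3 : I.vars f 3 ∉ bdry I J₀ := fun h3 => hnc ⟨not_not.1 h2, h3⟩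
        exact mem_sharedSlots.2 ⟨hfJ, (by decide : 2 ≤ (3 : Fin 4).val), two_le_mult_of_not_mem_bdry I hfJ (vars_mem_varSet I f 3) h3⟩
    · obtain ⟨f, hf, rfl⟩ := mem_image.1 hp
      exact mem_sharedSlots.2 ⟨hN₀ hf, (by decide : 2 ≤ (3 : Fin 4).val), two_le_mult_of_not_mem_bdry I (hN₀ hf) (vars_mem_varSet I f 3) (hboth f hf).2⟩
  have := card_le_card hsub
  rw [card_union_of_disjoint hAB, hAcard, hBcard] at this
  exact this

end Summit.PneNP.PneNP.Theorems.PstarGateBudgetTools
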